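import Summits.AnomalousDissipation.AnomalousDissipation.Theses.StirringSphere
import Summits.AnomalousDissipation.AnomalousDissipation.Theses.Ensemble
import Literature.Analysis.FluidPDE.StatisticalSolutionEnergyEq

/-!
# Sketch for the crux idea `dissipative-fp-class` (stmt-AnomalousDissipation-0215, seat b1)

Typed content: the class predicate `CylEnergyIneq` (= the inline hypothesis `CEI` of the registered
line `augmented-lift`), the crux RESTATED over the smaller class "Foias–Prodi + CEI"
(`EnsembleRealizationDiss`, a candidate item for the tenure planners of Ensemble / StirringSphere),
the one-line logic by which the restated item plus `stub_cylEnergyIneq` gives back the filed crux,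
and the first (sanity) lemma of the class: Diracs at steady states belong to it.
-/

noncomputable section

set_option linter.dupNamespace false

open MeasureTheory Set Filter Topology Function
open scoped BigOperators ENNReal InnerProductSpace RealInnerProductSpace

namespace Summit.AnomalousDissipation.AnomalousDissipation.Cruxes.EnsembleRealization.DissipativeClass

open Literature.Analysis.FunctionSpaces Literature.Analysis.FunctionSpaces.Torus
open Literature.Analysis.FluidPDE Literature.Analysis.FluidPDE.Torus

/-- **Cylindrically weighted energy inequalities** `CEI(ν, f, μ)` (verbatim the inline hypothesis of
`augmented-lift`'s `stub_augmentedLift`): the Foias–Prodi shell inequality (1.31) conditioned on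
cylindrical data. -/
def CylEnergyIneq (ν : ℝ) (f : UnitAddTorus (Fin 3) → EuclideanSpace ℝ (Fin 3))
    (μ : Measure (Torus.energySpace (Fin 3))) : Prop :=
  ∀ (m : ℕ) (g : Fin m → UnitAddTorus (Fin 3) → EuclideanSpace ℝ (Fin 3)),
      (∀ j, IsSmooth (g j)) → (∀ j, IsDivFree (g j)) → (∀ j, HasZeroMean (g j)) →
      ∀ ψ : EuclideanSpace ℝ (Fin m) × ℝ → ℝ, ContDiff ℝ 1 ψ →
        (∃ C : ℝ, ∀ z, |ψ z| ≤ C ∧ ‖fderiv ℝ ψ z‖ ≤ C) →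
        (∀ ξ : EuclideanSpace ℝ (Fin m), Monotone fun e : ℝ => ψ (ξ, e)) →
        Integrable (fun u : Torus.energySpace (Fin 3) =>
            fderiv ℝ ψ (WithLp.toLp 2 fun j => pairing u.1 (g j), ‖u‖ ^ 2) (0, 1) *
              (ν * (eGradNormSq (u.1 : UnitAddTorus (Fin 3) → EuclideanSpace ℝ (Fin 3))).toReal - pairing u.1 f)) μ ∧
        Integrable (fun u : Torus.energySpace (Fin 3) =>
            nsGeneratorPairing ν f u (fun x => ∑ j, fderiv ℝ ψ (WithLp.toLp 2 fun j => pairing u.1 (g j), ‖u‖ ^ 2)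
              (EuclideanSpace.single j 1, 0) • g j x)) μ ∧
        2 * ∫ u, fderiv ℝ ψ (WithLp.toLp 2 fun j => pairing u.1 (g j), ‖u‖ ^ 2) (0, 1) *
              (ν * (eGradNormSq (u.1 : UnitAddTorus (Fin 3) → EuclideanSpace ℝ (Fin 3))).toReal - pairing u.1 f) ∂μ ≤
          ∫ u, nsGeneratorPairing ν f u (fun x => ∑ j, fderiv ℝ ψ (WithLp.toLp 2 fun j => pairing u.1 (g j), ‖u‖ ^ 2)
              (EuclideanSpace.single j 1, 0) • g j x) ∂μ

/-- The crux RESTATED over the dissipative class (candidate item for the tenure planners; NOT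
filed by this seat): realisation is asked only of Foias–Prodi measures satisfying `CEI`. With it,
`closes` needs the targets to produce `CEI` measures — automatic for every time-average /
Vishik–Fursikov / Galerkin-limit construction. -/
def EnsembleRealizationDiss : Prop :=
  ∀ f : UnitAddTorus (Fin 3) → EuclideanSpace ℝ (Fin 3), IsSmooth f → IsDivFree f → HasZeroMean f →
    ∀ (E ε : ℝ), 0 < ε → ∃ M : ℝ, ∀ (ν : ℝ) (μ : Measure (Torus.energySpace (Fin 3))), 0 < ν →
      IsStationaryStatisticalSolution ν f μ → CylEnergyIneq ν f μ →
      Integrable (fun u => ‖u‖ ^ 2) μ → ensembleEnergy μ ≤ E → ε ≤ ensembleDissipation ν μ →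
      ∃ (u₀ : UnitAddTorus (Fin 3) → EuclideanSpace ℝ (Fin 3)) (u : ℝ → UnitAddTorus (Fin 3) → EuclideanSpace ℝ (Fin 3)),
        IsGlobalLerayHopf ν (fun _ => f) u₀ u ∧ meanEnergy u ≤ M ∧ ε / 2 ≤ meanDissipation ν u

/-- The filed crux from the restated one and `stub_cylEnergyIneq` (FP ⇒ CEI): pure logic. -/
theorem ensembleRealization_of_diss
    (hcei : ∀ (ν : ℝ) (f : UnitAddTorus (Fin 3) → EuclideanSpace ℝ (Fin 3))
      (μ : Measure (Torus.energySpace (Fin 3))), 0 < ν → IsSmooth f → IsDivFree f → HasZeroMean f →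
      IsStationaryStatisticalSolution ν f μ → CylEnergyIneq ν f μ)
    (hdiss : EnsembleRealizationDiss) :
    Summit.AnomalousDissipation.AnomalousDissipation.Theses.StirringSphere.EnsembleRealization := by
  intro f hs hdiv hz E ε hε
  obtain ⟨M, hM⟩ := hdiss f hs hdiv hz E ε hε
  exact ⟨M, fun ν μ hν hμ hint hE hεμ => hM ν μ hν hμ (hcei ν f μ hν hs hdiv hz hμ) hint hE hεμ⟩

/-- **First (sanity) lemma of the class.** The Dirac measure at a steady weak solution `u* ∈ V`
satisfies `CEI`: both sides vanish (steady energy equation `ν‖u*‖_V² = (f, u*)` in `d ≤ 4`,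
`⟨F(u*), w⟩ = 0`). Provable now (pattern of `isStationaryStatisticalSolution_dirac_holds`). -/
theorem cylEnergyIneq_dirac {ν : ℝ} (hν : 0 < ν) {f : UnitAddTorus (Fin 3) → EuclideanSpace ℝ (Fin 3)}
    (hf : IsSmooth f) {u : Torus.energySpace (Fin 3)}
    (hV : (u : Lp (EuclideanSpace ℝ (Fin 3)) 2 (volume : Measure (UnitAddTorus (Fin 3)))) ∈ Torus.energySpaceV (Fin 3))
    (hu : IsSteadyWeakSolution ν f u) :
    CylEnergyIneq ν f (Measure.dirac u) := by
  sorry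

/-- **First lemma of the OPEN stub in flux form** (the `m`-independent core a prover attacks):
for a Foias–Prodi measure and a nonnegative bounded continuous weight of (finitely many
coordinates, resolved energy), the weighted mean energy flux through wavenumber `K` has a
NONNEGATIVE inferior limit. (`−inertialPairing u (P_K u) = b(u, u, P_K u)`.) OPEN. -/
theorem liminf_weightedFlux_nonneg {ν : ℝ} (hν : 0 < ν) {f : UnitAddTorus (Fin 3) → EuclideanSpace ℝ (Fin 3)}
    (hf : IsSmooth f) (hdiv : IsDivFree f) (hf0 : HasZeroMean f) {μ : Measure (Torus.energySpace (Fin 3))}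
    (hμ : IsStationaryStatisticalSolution ν f μ) {m : ℕ}
    (g : Fin m → UnitAddTorus (Fin 3) → EuclideanSpace ℝ (Fin 3))
    (hg : ∀ j, IsSmooth (g j)) (hgd : ∀ j, IsDivFree (g j)) (hg0 : ∀ j, HasZeroMean (g j))
    (φ : EuclideanSpace ℝ (Fin m) × ℝ → ℝ) (hφ : Continuous φ) (hφ0 : ∀ z, 0 ≤ φ z)
    (hφb : ∃ C, ∀ z, φ z ≤ C) :
    0 ≤ liminf (fun K : ℕ => ∫ u, φ (WithLp.toLp 2 fun j => pairing u.1 (g j), truncNormSq K u) *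
      (-(inertialPairing (u.1 : Lp (EuclideanSpace ℝ (Fin 3)) 2 (volume : Measure (UnitAddTorus (Fin 3))))
        (fourierTruncate K (u.1 : UnitAddTorus (Fin 3) → EuclideanSpace ℝ (Fin 3))))) ∂μ) atTop := by
  sorry

end Summit.AnomalousDissipation.AnomalousDissipation.Cruxes.EnsembleRealization.DissipativeClass
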